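import Literature.NumberTheory.EllipticCurves.HuShuYin2019.SylvesterHeegnerHeightDisplay
import Literature.NumberTheory.EllipticCurves.HuShuYin2019.SylvesterNineMinimalModel
import Literature.NumberTheory.EllipticCurves.HeegnerPointsOfConductor
import Literature.NumberTheory.EllipticCurves.CubicTwistTransportJZero
import Literature.NumberTheory.EllipticCurves.VariableChangePointsMap
import Literature.NumberTheory.EllipticCurves.SelmerCorankProofs
import HarnessLib

/-!
# Hu–Shu–Yin 2019: the Heegner-height display (bsd) WITH THE POINT NAMED — `Y = R − T`,
# `R = φ(R₁)`, `R₁ = Tr_{H_{9p}/L_{(3,p)}} P₀`, for `E_p : x³ + y³ = p` at the prime `2`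

Topic `NumberTheory/EllipticCurves/HuShuYin2019`; namespace `Literature.NumberTheory.EllipticCurves.HuShuYin2019`.
Sequel of `SylvesterHeegnerHeightDisplay.lean`, whose named fact `shaAnPair_mul_height_eq_two_zpow_mul_height`
transcribes the display (bsd) of p. 12 with the point `Y` only asserted to EXIST («WEAKER THAN PRINT … TODO(general
form): `Y` is the explicit point `φ′(R − T)`, `R = Tr_{H_{3p}/L_{(p)}} φ(P₀)`»).  This file files that general form:
ONE named fact `shaAnPair_mul_height_eq_two_zpow_mul_height_named` (a `Prop`; consumers take
`(h : shaAnPair_mul_height_eq_two_zpow_mul_height_named)`; no `_holds` — the proof is the paper's §§2–4) whose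
conjunct (1) is the old display verbatim and whose conjunct (2) NAMES the point in the tree's vocabulary, plus two
PROVED corollaries: `shaAnPair_mul_height_eq_two_zpow_mul_height_of_named` (the old fact) and `disp₀_of_named`
(the consumer's DISP₀, below).  Requested by the crux `UpperOffV0HSYPlus` (stmt-BirchSwinnertonDyer-19804): the
binder `h` of `Summits/…/Theorems/SylvesterTwoHeegnerIndexCoupledDescentLayerL1OfPoint.layerL1Four_of_point`
(p653566) asks, per member `p ≡ 4 (9)` and model `K ∋ ω`, for `∃ Y₁ : E_p(K), DISP₀(Y₁) ∧ (Y₁ ∉ 2E_p(K) → (L1)[δY₁])`,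
and DISP₀ must be known for the CM bottom point itself (on the `m(p) = 0` slice Thm B′ turns DISP₀(`Y₁`) into
`Y₁ ∉ 2E_p(K)`); «some `Y`» does not serve.

## THE PRINT (Y. Hu, J. Shu, H. Yin, Trans. AMS 372 (2019), arXiv:1708.05266; page/line refs to the arXiv text)

* p. 4 L3–9: «the elliptic curve `E_n` has Weierstrass equation `y² = x³ − 432n²` … We fix the complex
  multiplication … by `[ω](x,y) = (ωx, y)`. … Let `f : X₀(3⁵) → E₉` be the natural modular parametrization. The
  Heegner point `f(τ)` is defined over the ring class field `H_{9p}` over `K` of conductor `9p`.»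
* p. 5 L76: «`E₉` is the natural quotient of `X₀(3⁵)` by the finite group `S₃`»; p. 10 L59: «Let `f : X₀(3⁵) → E₉`
  be a nontrivial modular parametrization which sends the infinity cusp `[∞]` to the zero element `O`. Explicitly,
  we may take `f` to be the quotient map `X₀(3⁵) → X_Γ = E₉`»; p. 11 L23: «`(f,f)_{R′} = (Vol(X_{R′×})/Vol(X_{R×}))
  deg f = 6 · Vol(R^×)/Vol(R′^×) = 4`» — so `deg f = 6`.
* Prop. 2.4 (p. 6 L135–p. 7 L5): «`H_{9p} = H_{3p}(∛3)` with `Gal(H_{9p}/H_{3p}) = ⟨σ_{1+3ω₃}⟩ ≃ ℤ/3`, and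
  `(∛3)^{σ_{1+3ω₃}−1} = ω²`. We have `(∛3)^{σ_{ω₃}−1} = 1` and `(∛p)^{σ_{ω₃}−1} = ω²` (`p ≡ 4 mod 9`), `ω`
  (`p ≡ 7 mod 9`)»; field diagram p. 7 L37–44: `L_{(3,p)} = K(∛3, ∛p)`, `L_{(p)} = K(∛p)`, `[H_{9p} : H_{3p}] = 3`,
  `[H_{3p} : L_{(p)}] = (p−1)/3`.
* p. 7 L25–60: «Consider the isomorphism `φ : E₉ → E₁, (x,y) ↦ ((∛3)²x, 3y)` … Put `Q = φ(P₀)` and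
  `R = Tr_{H_{3p}/L_{(p)}} Q`. COROLLARY 2.5. The point `R ∈ E₁(L_{(p)})` and satisfies `R^{σ_{ω₃}} = [ω²]R + (0, 12√−3)`
  (`p ≡ 4 mod 9`), `[ω]R + (0, −12√−3)` (`p ≡ 7 mod 9`) … Recall that the cusp `(0, 12√−3)` is a `3`-torsion.»
* p. 8 L9–75: Lemma 3.1 (`R ≡ (12ω^{i+2}, −36) mod 𝔓`, «where `i = 0,1,2` depends on `p`»); «Put `T = (12ω^{i+2}, −36)`
  which satisfies the relations `T = [ω²]T + (0,12√−3)`, `T = [ω]T + (0,−12√−3)`. Let `α = 2` or `1` according to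
  `p ≡ 4` or `7 mod 9` respectively. By Theorem (co: Galois), the point `Y = R − T` belongs to `E₁(L_{(p)})^{σ_{ω₃}=ω^α}`
  which is identified with `E_p(K)` under the isomorphism `(x,y) ↦ ((∛p)²x, py)` defined over `L_{(p)}`. … By the work
  of Dasgupta and Voight [DV17], we know that the free component of `E_p(K)` has rank `1` over `O_K`, and we have
  `K ⊗_{O_K} E_p(K) ≃ K`.»
* §4.1 p. 10 L92–94: «Recall `τ = (2pω−9)/(9pω−36) ∈ ℋ` and let `P₁ = [τ,1]_{U₀(3⁵)}` be the CM point on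
  `X₀(3⁵)(H_{9p})` and note that `f(P₁) = P₀`. Define the Heegner point `R₁ = Tr_{H_{9p}/L_{(3,p)}} P₀ ∈ E₉(L_{(3,p)})`.»
  Thm. 4.3 / «`φ(R₁) = R`» / COROLLARY 4.4 (p. 11): «`L′(1,E_p)L(1,E_{3p²})/(Ω_pΩ_{3p²}) = 2^α · 9 · ĥ_ℚ(R)`, where
  `α = 0` if `p ≡ 4 mod 9` and `α = −1` if `p ≡ 7 mod 9`.»
* p. 12 L52–75 (proof of Thm. 1.4): «By [ZK], we know that `c_p(E_p) = 3`, `c₃(E_p) = 1` or `2` depending on `p`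
  congruent to `4` or `7` modulo `9` respectively, and `c_ℓ(E_p) = 1` for primes `ℓ ≠ 3, p`, while `c_p(E_{3p²}) = 3`,
  `c_ℓ(E_{3p²}) = 1` for primes `ℓ ≠ p`. Let `P` be the generator of the free part of `E_p(ℚ)`. … By Theorem (thm:GZ)
  and Corollary (co:GZ), we expect (bsd) `|Ш(E_p)|·|Ш(E_{3p²})| = 2^i ĥ_ℚ(R)/ĥ_ℚ(P)`, where `i = 0` resp. `i = −2`
  if `p ≡ 4 mod 9` resp. `p ≡ 7 mod 9`. Note the RHS of (bsd) is a nonzero rational number.»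

## THE TRANSCRIPTION (what conjunct (2) of the fact says; decisions settled from the paper — planner D464/D467)

The outer binders and the DISPLAY are those of `shaAnPair_mul_height_eq_two_zpow_mul_height` VERBATIM
(`B ≅ E_p`, `A ≅ E_{3p²}` globally minimal over `ℚ`; `RHS(bsd1) = #Ш_an(B)·#Ш_an(A)` = the tree's `shaAn`;
`K ∋ ω` with `ω² + ω + 1 = 0`, `[K : ℚ] = 2`; heights `ĥ_K` on `B_K` through `ι = QuadraticDescent.incl K B`, the
factor `[K:ℚ] = 2` cancelling in the printed RATIO `ĥ_ℚ(R)/ĥ_ℚ(P)`; exponent `i = 0 / −2`).  The point is named thus: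

* THE PARAMETRISATION `Dt : ModularParametrizationData W₀ 243`, `W₀ = ⟨0,0,1,0,−1⟩` (`y² + y = x³ − 1`, the
  globally minimal model of `E₉`, `HuShuYin2019/SylvesterNineMinimalModel`), WITH `Dt.deg = 6`: HSY's `f` IS the
  `S₃`-quotient map of degree `6`.  CONSUMPTION NOTE: a consumer's `Dt` must have `deg = 6`; a datum at level `243`
  for `W₀` with another Manin multiple is `[α] ∘ f` for some `α` (same newform, same Néron lattice, same
  uniformisation) and scales `R₁` by `α` and `ĥ(R₁)` by `N(α)`, of degree `6·N(α)` — that rescaled display is NOT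
  transcribed here.
* THE CM POINT `y₁ ∈ W₀(K[9p])` with `map y₁ = Dt.φ (heegnerTau (81(p²+4p+16), −9(4p²+17p+72), 4p²+18p+81))` — the
  shape of `Summits/…/SylvesterTwoHeegnerIndexCMDataRationality.exists_map_eq_phi_sylvesterTau_one…` VERBATIM
  (HSY's `P₀ = f(P₁)`, `P₁ = [τ,1]`, on `E₉`'s minimal model; `K[9p] = ringClassField K ι₀ (9p) ⊂ ℂ` is `H_{9p}`).
* THE TRACE `R₁ = Σ_{g ∈ G} pointGalHom W₀ K[9p] g y₁` with `g ∈ G ↔ g` fixes `K`, `c₃` and `c_p` (`c₃³ = 3`,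
  `c_p³ = p` in `K[9p]`; `G = Gal(H_{9p}/L_{(3,p)})`, `L_{(3,p)} = K(∛3, ∛p)` whichever cube roots are taken, since
  `ω ∈ K`) = HSY's `R₁ = Tr_{H_{9p}/L_{(3,p)}} P₀` (p. 10 L94).
* THE TORSION TRANSLATE `T`: HSY's `T = (12ω^{i+2}, −36) ∈ E₁(K)[3]` pulled back along `φ` and the `ℚ`-isomorphisms
  `E₉ : y² = x³ − 48 ≅ cubeSumCurve 9 : y² = x³ − 432·81 ≅ W₀` is the `3`-torsion point `(t, −2)` of `W₀`, `t` a cube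
  root of `3` (`(12ζ, −36) ↤ (4∛3ζ′, −12) ↦ (36∛3ζ′, −324) ↦ (∛3ζ′, −2)`); WHICH of the `3`-torsion points it is
  depends on `i = i(p)` (Lemma 3.1), on the cube roots, and on the sign of the parametrisation (`Dt.φ = ±f`, not
  fixed by `Dt.deg = 6`; for `−f` the descending combination is `−(R₁ − T) = (−R₁) − (−T)`); the display (`T`
  torsion: `ĥ(R − T) = ĥ(R)`) and the consumer's `2`-divisibility test (`T = 2·(2T)`) do not see the choice.  The fact
  therefore lets `T` be SOME `3`-torsion point of `W₀(K[9p])` for which `R₁ − T` descends to `E_p(K)` — the role `T`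
  plays on p. 8 («`Y = R − T` belongs to `E₁(L_{(p)})^{σ_{ω₃}=ω^α}` which is identified with `E_p(K)`»).
* THE TRANSPORT to `E_p`, in the `K̄`-currency of the consumer (`GeomPointsEmbeddingDescent`, R0
  `exists_cmFrame_kolyvaginClass`: `geomPoints`, an embedding `emb : K[9p] → K̄` over `K` with its point map
  `ιpt = Affine.Point.map emb` given as a binder with `hιpt`): `κ : (cubeSumCurve 9)(K̄) ≃+ W₀(K̄)` PINNED by
  coordinates `(x, y) ↦ (x/36, (y − 108)/216)` (the `ℚ`-isomorphism `⟨6,0,0,108⟩ • cubeSumCurve 9 = W₀`,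
  `variableChange_six_smul_cubeSumCurve_nine`), and the sextic-twist isomorphism
  `ψ : (cubeSumCurve 9)(K̄) ≃+ (cubeSumCurve p)(K̄)` PINNED by `(x, y) ↦ (v²x, v³y)`, `v³ = p/9` — HSY's `φ` followed
  by `(x,y) ↦ ((∛p)²x, py)` (in `cubeSumCurve 9` coordinates `X = 9x`, `Y = 27y` this is `((3p)^{2/3}/9 · X, (p/9)·Y)`
  and `((p/9)^{1/3})² = (3p)^{2/3}/9`); `ℂ` enters only through `hy₁` and `shaAn`.
* THE ASSERTION: there are such a `T` and **a point `Y₁ ∈ E_p(K)` (`((cubeSumCurve p).baseChange K).Point`) with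
  `toGeomPoints Y₁ = ψ(κ⁻¹(ιpt(R₁ − T)))`** (the K-rationality IS print: p. 8, Cor. 2.5, Prop. 2.4 (2)), and for all
  minimal models `A, B`, `CB • B = cubeSumCurve p`: `∃ qB qA` (= `shaAn B`, `shaAn A`, nonzero), `rank_ℤ B(K) = 2`,
  a `ℚ`-generator `P` of `B` modulo torsion and `Y ∈ B(K)` with `(qB·qA)·ĥ_K(ιP) = 2^i·ĥ_K(Y)` AND
  `congrEquiv hCB (pointEquivBaseChange B CB K Y) = Y₁` — the transport clause of DISP₀ verbatim.

WHAT THIS IS NOT: not a proof (Shimura reciprocity on `X₀(3⁵)`, the explicit Gross–Zagier formula of Cai–Shu–Tian,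
local period integrals at `3`, Dasgupta–Voight — none of it in the tree); not BSD(`E_p`, 2); no χ-projector form
(`Σ_i ρ(t_i)(t_i • R₁) = 9R + torsion`, an odd factor `81` in `ĥ`) — if a consumer wants it, it is a corollary to be
PROVED from this fact and the CM action, not a second transcription; nothing about `p ≡ 7 (9)`'s halved point
(THEOREM C, crux 19802).  HONEST LABEL: a FACT; together with Thm B′
(`not_exists_two_smul_eq_of_padicValRat_eq`) it discharges the residual (D) of leaf (L1) of crux 19804 on the
`m(p) = 0` slice only; `X12.CMAtTwo` is NOT proved; BSD is not claimed for any curve.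

## References

* [HuShuYin2019] Y. Hu, J. Shu, H. Yin, *An explicit Gross–Zagier formula related to the Sylvester conjecture*,
  Trans. Amer. Math. Soc. 372 (2019), 6905–6925; arXiv:1708.05266: p. 4, p. 5 L76, Prop. 2.4, p. 7 (φ, Q, R,
  Cor. 2.5), p. 8 (Lemma 3.1, T, Y = R − T, E_p(K)), §4.1 p. 10 L59, L92–94 (f, P₁, R₁), p. 11 (Thm. 4.3, Cor. 4.4,
  deg f = 6), p. 12 ((bsd), Tamagawa numbers).
* [DV17] S. Dasgupta, J. Voight, *Sylvester's problem and mock Heegner points*, Proc. AMS 146 (2018) (rank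
  statements quoted on p. 8 and p. 11 of [HuShuYin2019]).
* [GrossLMS1991] B. H. Gross, *Kolyvagin's work on modular elliptic curves*, LMS LNS 153 (1991), §3 (the ring class
  tower `K[n] ⊂ ℂ`, traces as sums over `Gal`).

## Mathlib / tree search

Tree (reused by name): `shaAnPair_mul_height_eq_two_zpow_mul_height`, `cubeSumCurve`, `shaAn`, `canonicalHeight`,
`mordellWeilRank`, `QuadraticDescent.incl` (`SylvesterHeegnerHeightDisplay` and its imports); `ringClassField`,
`pointGalHom`, `heegnerTau`, `ModularParametrizationData(.φ, .deg)` (`HeegnerPointsOfConductor`, `HeegnerPoints`,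
`ModularCurve`); `geomPoints`, `toGeomPoints` (`GaloisAction`, `SelmerCorankProofs`); `Affine.Point.congrEquiv`,
`VariableChange.pointEquivBaseChange` (`VariableChangePointsMap`); `variableChange_six_smul_cubeSumCurve_nine`
(`SylvesterNineMinimalModel`, for the coordinates of `κ`); `exists_cubicTwist_addEquiv` (`CubicTwistTransportJZero`,
the shape of `hψ`).  `lean search 'shaAnPair|HeightDisplay|_named'`: only the predecessor fact; no other transcription
of HSY Cor. 4.4 in `Literature/` or `Summits/` (the `Summits/…/SylvesterTwoHeegnerIndex*` files consume the old fact).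
-/

noncomputable section

open scoped Classical

open WeierstrassCurve WeierstrassCurve.Affine WeierstrassCurve.Affine.Point

namespace Literature.NumberTheory.EllipticCurves.HuShuYin2019

open Literature.NumberTheory.EllipticCurves Literature.NumberTheory.EllipticCurves.ModularForms

/-- **Hu–Shu–Yin 2019, display (bsd) (p. 12) with Cor. 4.4 (p. 11), Thm. 4.3, §4.1 (p. 10 L92–94), §3 (p. 8) and §2
(p. 7, Prop. 2.4, Cor. 2.5) — WITH THE POINT NAMED.**  For a prime `p ≡ 4, 7 (mod 9)` with `3` not a cube mod `p`,
minimal models `B ≅ E_p`, `A ≅ E_{3p²}`, and `K ∋ ω` (`ω² + ω + 1 = 0`, `[K:ℚ] = 2`): (1) [the transcription of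
`shaAnPair_mul_height_eq_two_zpow_mul_height`, verbatim] `RHS(bsd1) = #Ш_an(B)·#Ш_an(A) =: qB·qA` is a nonzero
rational, `rank_ℤ B(K) = 2`, and for the generator `P` of `B(ℚ)` modulo torsion and SOME `Y ∈ B(K)`,
`(qB·qA)·ĥ_K(ιP) = 2^i·ĥ_K(Y)`, `i = 0` (`p ≡ 4 (9)`), `−2` (`p ≡ 7 (9)`) — VERBATIM p. 12: «we expect (bsd)
`|Ш(E_p)|·|Ш(E_{3p²})| = 2^i ĥ_ℚ(R)/ĥ_ℚ(P)` … Note the RHS of (bsd) is a nonzero rational number», Cor. 4.4: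
«`L′(1,E_p)L(1,E_{3p²})/(Ω_pΩ_{3p²}) = 2^α·9·ĥ_ℚ(R)`», with the constants `c_p(E_p) = 3`, `c₃(E_p) = 1 | 2`,
`c_p(E_{3p²}) = 3`, other `c_ℓ = 1`, trivial torsion ([ZK], p. 12) inserted; AND (2) [THE NAMING] for every
`ι₀ : K → ℂ`, every modular parametrisation datum `Dt` of `W₀ = ⟨0,0,1,0,−1⟩` (minimal model of `E₉`) at level
`243` of degree `6` (HSY's `f` = the `S₃`-quotient map, p. 5 L76 / p. 10 L59 / p. 11 L23), the CM point
`y₁ ∈ W₀(K[9p])` over `Dt.φ(τ_{Q_p})` (HSY's `P₀ = f(P₁)`, p. 10 L92), cube roots `c₃, c_p ∈ K[9p]` of `3, p`, the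
subgroup `G = Gal(K[9p]/K(c₃, c_p))` (as a `Finset` with `hG`; `K(∛3, ∛p) = L_{(3,p)}`, p. 7), an embedding
`emb : K[9p] → K̄` over `K` with its point map `ιpt`, the `ℚ`-isomorphism `κ : cubeSumCurve 9 ≅ W₀` on
`K̄`-points (coordinates `(x/36, (y−108)/216)`), a cube root `v` of `p/9` in `K̄` and the sextic twist
`ψ : (x,y) ↦ (v²x, v³y)` from `cubeSumCurve 9` to `cubeSumCurve p` on `K̄`-points (HSY's `φ : (x,y) ↦ (∛3²x, 3y)`
followed by `(x,y) ↦ (∛p²x, py)`, pp. 7–8): THERE ARE a `3`-torsion point `T ∈ W₀(K[9p])` (HSY's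
`T = (12ω^{i+2}, −36)`, p. 8 — «Put `T = (12ω^{i+2}, −36)` …»; on `W₀` a point `(t, −2)`, `t³ = 3`, up to the sign
of the parametrisation; WHICH `3`-torsion point is immaterial for `ĥ` and for `2`-divisibility) AND A POINT
**`Y₁ ∈ E_p(K)` whose image in `E_p(K̄)` is `ψ(κ⁻¹(ιpt(R₁ − T)))`, `R₁ = Σ_{g ∈ G} g·y₁ = Tr_{H_{9p}/L_{(3,p)}} P₀`**
(p. 10 L94; p. 8: «the point `Y = R − T` belongs to `E₁(L_{(p)})^{σ_{ω₃}=ω^α}` which is identified with `E_p(K)`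
under the isomorphism `(x,y) ↦ ((∛p)²x, py)`»; `φ(R₁) = R`, p. 11), such that for all minimal models `A, B` and
`CB • B = cubeSumCurve p` the display of (1) holds with `Y :=` the transport of `Y₁` to `B(K)`
(`congrEquiv hCB (pointEquivBaseChange B CB K Y) = Y₁`).  TRANSCRIPTION NOTES: heights as in (1) (`ĥ_K`, ratio
convention); `shaAn B = (qB : ℂ)`; a `Dt` of another degree is `[α]∘f` and is NOT covered (consumption note in the
module docstring).  STATUS PUB (Trans. AMS); a FACT, not our theorem.
[cite: HuShuYin2019, display (bsd) p. 12, Cor. 4.4 and Thm. 4.3 (p. 11), §4.1 p. 10 L92–94, §3 p. 8 L9–75, §2 p. 7 L25–60 and Prop. 2.4]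
[file NumberTheory/EllipticCurves/HuShuYin2019/SylvesterHeegnerHeightDisplayNamed] -/
def shaAnPair_mul_height_eq_two_zpow_mul_height_named : Prop :=
  ∀ (p : ℕ), p.Prime → (p % 9 = 4 ∨ p % 9 = 7) → (¬ ∃ x : ZMod p, x ^ 3 = 3) →
    ∀ (K : Type) [Field K] [NumberField K] (ω : K), ω ^ 2 + ω + 1 = 0 → Module.finrank ℚ K = 2 →
      -- (1) the display (bsd) as in `shaAnPair_mul_height_eq_two_zpow_mul_height` (`Y` existential)
      (∀ (A B : WeierstrassCurve ℚ) [A.IsElliptic] [A.IsGloballyMinimal]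
          [B.IsElliptic] [B.IsGloballyMinimal],
        (∃ C : VariableChange ℚ, C • B = cubeSumCurve (p : ℚ)) →
        (∃ C : VariableChange ℚ, C • A = cubeSumCurve (3 * (p : ℚ) ^ 2)) →
        ∃ qB qA : ℚ, shaAn B = (qB : ℂ) ∧ shaAn A = (qA : ℂ) ∧ qB * qA ≠ 0 ∧
          (B.baseChange K).mordellWeilRank = 2 ∧
          ∃ (P : B.toAffine.Point) (Y : (B.baseChange K).toAffine.Point),
            ¬ IsOfFinAddOrder (WeierstrassCurve.QuadraticDescent.incl K B P) ∧
            (∀ Q : B.toAffine.Point, ∃ m : ℤ, IsOfFinAddOrder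
              (WeierstrassCurve.QuadraticDescent.incl K B Q -
                m • WeierstrassCurve.QuadraticDescent.incl K B P)) ∧
            ((qB * qA : ℚ) : ℝ) * canonicalHeight (WeierstrassCurve.QuadraticDescent.incl K B P) =
              (2 : ℝ) ^ (if p % 9 = 4 then (0 : ℤ) else -2) * canonicalHeight Y) ∧
      -- (2) THE NAMING CLAUSE: the same display holds with `Y :=` Hu–Shu–Yin's point `R − T` on `E_p(K)`
      ∀ (ι₀ : K →+* ℂ)
        (Dt : ModularParametrizationData (⟨0, 0, 1, 0, -1⟩ : WeierstrassCurve ℚ) 243), Dt.deg = 6 →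
      ∀ (y₁ : ((⟨0, 0, 1, 0, -1⟩ : WeierstrassCurve ℚ).baseChange
          (ringClassField K ι₀ (9 * p))).toAffine.Point),
        Affine.Point.map (W' := (⟨0, 0, 1, 0, -1⟩ : WeierstrassCurve ℚ))
            (ringClassField K ι₀ (9 * p)).subtype.toRatAlgHom y₁ =
          Dt.φ (heegnerTau (81 * ((p : ℤ) ^ 2 + 4 * p + 16), -(9 * (4 * (p : ℤ) ^ 2 + 17 * p + 72)),
            4 * (p : ℤ) ^ 2 + 18 * p + 81)) →
      ∀ (c₃ cp : ringClassField K ι₀ (9 * p)), c₃ ^ 3 = 3 → cp ^ 3 = (p : ringClassField K ι₀ (9 * p)) →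
      ∀ (G : Finset (ringClassField K ι₀ (9 * p) ≃ₐ[ℚ] ringClassField K ι₀ (9 * p))),
        (∀ g, g ∈ G ↔ (∀ k : K, g (algebraMap K (ringClassField K ι₀ (9 * p)) k) =
          algebraMap K (ringClassField K ι₀ (9 * p)) k) ∧ g c₃ = c₃ ∧ g cp = cp) →
      ∀ (emb : ringClassField K ι₀ (9 * p) →+* AlgebraicClosure K),
        (∀ k : K, emb (algebraMap K (ringClassField K ι₀ (9 * p)) k) =
          algebraMap K (AlgebraicClosure K) k) →
      ∀ (ιpt : ((⟨0, 0, 1, 0, -1⟩ : WeierstrassCurve ℚ).baseChange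
            (ringClassField K ι₀ (9 * p))).toAffine.Point →+
          geomPoints (((⟨0, 0, 1, 0, -1⟩ : WeierstrassCurve ℚ)).baseChange K)),
        (∀ Q, ιpt Q = Affine.Point.map (W' := (⟨0, 0, 1, 0, -1⟩ : WeierstrassCurve ℚ))
          emb.toRatAlgHom Q) →
      ∀ (κ : geomPoints ((cubeSumCurve (9 : ℚ)).baseChange K) ≃+
          geomPoints (((⟨0, 0, 1, 0, -1⟩ : WeierstrassCurve ℚ)).baseChange K)),
        (∀ {x y : AlgebraicClosure K}
          (h : (((cubeSumCurve (9 : ℚ)).baseChange K).baseChange (AlgebraicClosure K)).toAffine.Nonsingular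
            x y),
          ∃ h', κ (Affine.Point.some x y h) = Affine.Point.some (x / 36) ((y - 108) / 216) h') →
      ∀ (v : AlgebraicClosure K), v ^ 3 = (p : AlgebraicClosure K) / 9 →
      ∀ (ψ : geomPoints ((cubeSumCurve (9 : ℚ)).baseChange K) ≃+
          geomPoints ((cubeSumCurve (p : ℚ)).baseChange K)),
        (∀ {x y : AlgebraicClosure K}
          (h : (((cubeSumCurve (9 : ℚ)).baseChange K).baseChange (AlgebraicClosure K)).toAffine.Nonsingular
            x y),
          ∃ h', ψ (Affine.Point.some x y h) = Affine.Point.some (v ^ 2 * x) (v ^ 3 * y) h') →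
      ∃ T : ((⟨0, 0, 1, 0, -1⟩ : WeierstrassCurve ℚ).baseChange (ringClassField K ι₀ (9 * p))).toAffine.Point,
        3 • T = 0 ∧
      ∃ Y₁ : ((cubeSumCurve (p : ℚ)).baseChange K).toAffine.Point,
        toGeomPoints ((cubeSumCurve (p : ℚ)).baseChange K) Y₁ =
          ψ (κ.symm (ιpt ((∑ g ∈ G, pointGalHom (⟨0, 0, 1, 0, -1⟩ : WeierstrassCurve ℚ)
            (ringClassField K ι₀ (9 * p)) g y₁) - T))) ∧
        ∀ (A B : WeierstrassCurve ℚ) [A.IsElliptic] [A.IsGloballyMinimal]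
            [B.IsElliptic] [B.IsGloballyMinimal] (CB : VariableChange ℚ)
            (hCB : CB • B = cubeSumCurve (p : ℚ)),
          (∃ C : VariableChange ℚ, C • A = cubeSumCurve (3 * (p : ℚ) ^ 2)) →
          ∃ qB qA : ℚ, shaAn B = (qB : ℂ) ∧ shaAn A = (qA : ℂ) ∧ qB * qA ≠ 0 ∧
            (B.baseChange K).mordellWeilRank = 2 ∧
            ∃ (P : B.toAffine.Point) (Y : (B.baseChange K).toAffine.Point),
              ¬ IsOfFinAddOrder (WeierstrassCurve.QuadraticDescent.incl K B P) ∧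
              (∀ Q : B.toAffine.Point, ∃ m : ℤ, IsOfFinAddOrder
                (WeierstrassCurve.QuadraticDescent.incl K B Q -
                  m • WeierstrassCurve.QuadraticDescent.incl K B P)) ∧
              ((qB * qA : ℚ) : ℝ) * canonicalHeight (WeierstrassCurve.QuadraticDescent.incl K B P) =
                (2 : ℝ) ^ (if p % 9 = 4 then (0 : ℤ) else -2) * canonicalHeight Y ∧
              Affine.Point.congrEquiv (congrArg (fun W : WeierstrassCurve ℚ ↦ W.baseChange K) hCB)
                (VariableChange.pointEquivBaseChange B CB K Y) = Y₁

/-- **The existing transcription is a corollary**: `…_named → shaAnPair_mul_height_eq_two_zpow_mul_height`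
(conjunct (1) of the named fact is the old display verbatim). [cite: HuShuYin2019, display (bsd) (p. 12)] -/
theorem shaAnPair_mul_height_eq_two_zpow_mul_height_of_named
    (h : shaAnPair_mul_height_eq_two_zpow_mul_height_named) :
    shaAnPair_mul_height_eq_two_zpow_mul_height := by
  intro p hp h49 h3 A B _ _ _ _ hB hA K _ _ ω hω h2
  exact (h p hp h49 h3 K ω hω h2).1 A B hB hA

/-- **DISP₀ NAMING `P₁^{χ_B}` — the consumer corollary** (the `∀ A B … = Y₁` block of the binder `h` of
`Summits/…/Theorems/SylvesterTwoHeegnerIndexCoupledDescentLayerL1OfPoint.layerL1Four_of_point`, p653566,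
VERBATIM, for `p ≡ 4 (mod 9)`): granted the named fact, for every member `p ≡ 4 (9)` with `3 ∉ 𝔽_p^{×3}`,
every model `K ∋ ω` of `ℚ(ζ₃)` and every coherent naming datum (`ι₀, Dt` of degree `6`, the bottom CM point
`y₁`, cube roots `c₃, c_p ∈ K[9p]`, `G = Gal(K[9p]/K(c₃, c_p))`, an embedding `emb : K[9p] → K̄` over `K` with
its point map `ιpt`, the `ℚ`-isomorphism `κ` and the twist `ψ`), there are a `3`-torsion point `T ∈ W₀(K[9p])`
and a point **`Y₁ ∈ E_p(K)` with `Y₁ = ψ(κ⁻¹(ιpt(R₁ − T)))` in `E_p(K̄)`**, `R₁ = Σ_{g ∈ G} g·y₁`, such that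
DISP₀(`Y₁`) holds: for all minimal models and `qB = #Ш_an(B)`, `qA = #Ш_an(A)` there are a `ℚ`-generator `P`
of `B` and `Y ∈ B(K)` transporting to `Y₁` with `(qB·qA)·ĥ(ιP) = 2⁰·ĥ(Y)`.
[cite: HuShuYin2019, Cor. 4.4 (p. 11), display (bsd) (p. 12), §3 p. 8 (Y = R − T)] -/
theorem disp₀_of_named (hD : shaAnPair_mul_height_eq_two_zpow_mul_height_named)
    {p : ℕ} (hp : p.Prime) (hp4 : p % 9 = 4) (h3 : ¬ ∃ x : ZMod p, x ^ 3 = 3)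
    (K : Type) [Field K] [NumberField K] {ω : K} (hω : ω ^ 2 + ω + 1 = 0) (h2 : Module.finrank ℚ K = 2)
    (ι₀ : K →+* ℂ) (Dt : ModularParametrizationData (⟨0, 0, 1, 0, -1⟩ : WeierstrassCurve ℚ) 243)
    (hdeg : Dt.deg = 6)
    (y₁ : ((⟨0, 0, 1, 0, -1⟩ : WeierstrassCurve ℚ).baseChange (ringClassField K ι₀ (9 * p))).toAffine.Point)
    (hy₁ : Affine.Point.map (W' := (⟨0, 0, 1, 0, -1⟩ : WeierstrassCurve ℚ))
        (ringClassField K ι₀ (9 * p)).subtype.toRatAlgHom y₁ =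
      Dt.φ (heegnerTau (81 * ((p : ℤ) ^ 2 + 4 * p + 16), -(9 * (4 * (p : ℤ) ^ 2 + 17 * p + 72)),
        4 * (p : ℤ) ^ 2 + 18 * p + 81)))
    (c₃ cp : ringClassField K ι₀ (9 * p)) (hc₃ : c₃ ^ 3 = 3) (hcp : cp ^ 3 = (p : ringClassField K ι₀ (9 * p)))
    (G : Finset (ringClassField K ι₀ (9 * p) ≃ₐ[ℚ] ringClassField K ι₀ (9 * p)))
    (hG : ∀ g, g ∈ G ↔ (∀ k : K, g (algebraMap K (ringClassField K ι₀ (9 * p)) k) =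
      algebraMap K (ringClassField K ι₀ (9 * p)) k) ∧ g c₃ = c₃ ∧ g cp = cp)
    (emb : ringClassField K ι₀ (9 * p) →+* AlgebraicClosure K)
    (hemb : ∀ k : K, emb (algebraMap K (ringClassField K ι₀ (9 * p)) k) = algebraMap K (AlgebraicClosure K) k)
    (ιpt : ((⟨0, 0, 1, 0, -1⟩ : WeierstrassCurve ℚ).baseChange (ringClassField K ι₀ (9 * p))).toAffine.Point →+
      geomPoints (((⟨0, 0, 1, 0, -1⟩ : WeierstrassCurve ℚ)).baseChange K))
    (hιpt : ∀ Q, ιpt Q = Affine.Point.map (W' := (⟨0, 0, 1, 0, -1⟩ : WeierstrassCurve ℚ)) emb.toRatAlgHom Q)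
    (κ : geomPoints ((cubeSumCurve (9 : ℚ)).baseChange K) ≃+
      geomPoints (((⟨0, 0, 1, 0, -1⟩ : WeierstrassCurve ℚ)).baseChange K))
    (hκ : ∀ {x y : AlgebraicClosure K}
      (h : (((cubeSumCurve (9 : ℚ)).baseChange K).baseChange (AlgebraicClosure K)).toAffine.Nonsingular x y),
      ∃ h', κ (Affine.Point.some x y h) = Affine.Point.some (x / 36) ((y - 108) / 216) h')
    (v : AlgebraicClosure K) (hv : v ^ 3 = (p : AlgebraicClosure K) / 9)
    (ψ : geomPoints ((cubeSumCurve (9 : ℚ)).baseChange K) ≃+ geomPoints ((cubeSumCurve (p : ℚ)).baseChange K))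
    (hψ : ∀ {x y : AlgebraicClosure K}
      (h : (((cubeSumCurve (9 : ℚ)).baseChange K).baseChange (AlgebraicClosure K)).toAffine.Nonsingular x y),
      ∃ h', ψ (Affine.Point.some x y h) = Affine.Point.some (v ^ 2 * x) (v ^ 3 * y) h') :
    ∃ T : ((⟨0, 0, 1, 0, -1⟩ : WeierstrassCurve ℚ).baseChange (ringClassField K ι₀ (9 * p))).toAffine.Point,
      3 • T = 0 ∧
    ∃ Y₁ : ((cubeSumCurve (p : ℚ)).baseChange K).toAffine.Point,
      toGeomPoints ((cubeSumCurve (p : ℚ)).baseChange K) Y₁ =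
        ψ (κ.symm (ιpt ((∑ g ∈ G, pointGalHom (⟨0, 0, 1, 0, -1⟩ : WeierstrassCurve ℚ)
          (ringClassField K ι₀ (9 * p)) g y₁) - T))) ∧
      ∀ (A B : WeierstrassCurve ℚ) [A.IsElliptic] [A.IsGloballyMinimal] [B.IsElliptic]
          [B.IsGloballyMinimal] (CB : VariableChange ℚ)
          (hCB : CB • B = HuShuYin2019.cubeSumCurve (p : ℚ)),
        (∃ C : VariableChange ℚ, C • A = HuShuYin2019.cubeSumCurve (3 * (p : ℚ) ^ 2)) →
        ∀ (qB qA : ℚ), shaAn B = (qB : ℂ) → shaAn A = (qA : ℂ) →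
        ∃ (P : B.toAffine.Point) (Y : (B.baseChange K).toAffine.Point),
          ¬ IsOfFinAddOrder (WeierstrassCurve.QuadraticDescent.incl K B P) ∧
          (∀ Q : B.toAffine.Point, ∃ m : ℤ, IsOfFinAddOrder
            (WeierstrassCurve.QuadraticDescent.incl K B Q -
              m • WeierstrassCurve.QuadraticDescent.incl K B P)) ∧
          ((qB * qA : ℚ) : ℝ) * canonicalHeight (WeierstrassCurve.QuadraticDescent.incl K B P) =
            (2 : ℝ) ^ (0 : ℤ) * canonicalHeight Y ∧
          Affine.Point.congrEquiv (congrArg (fun W : WeierstrassCurve ℚ ↦ W.baseChange K) hCB)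
            (VariableChange.pointEquivBaseChange B CB K Y) = Y₁ := by
  obtain ⟨T, hT, Y₁, hY₁, hall⟩ := (hD p hp (Or.inl hp4) h3 K ω hω h2).2 ι₀ Dt hdeg y₁ hy₁ c₃ cp hc₃ hcp
    G hG emb hemb ιpt hιpt κ hκ v hv ψ hψ
  refine ⟨T, hT, Y₁, hY₁, ?_⟩
  intro A B _ _ _ _ CB hCB hA qB qA hqB hqA
  obtain ⟨qB', qA', hB', hA', -, -, P, Y, hP, hgen, hdisp, htr⟩ := hall A B CB hCB hA
  have hqB' : qB' = qB := by exact_mod_cast hB'.symm.trans hqB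
  have hqA' : qA' = qA := by exact_mod_cast hA'.symm.trans hqA
  subst hqB' hqA'
  refine ⟨P, Y, hP, hgen, ?_, htr⟩
  simpa [hp4] using hdisp

end Literature.NumberTheory.EllipticCurves.HuShuYin2019

end
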